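import Literature.MathematicalPhysics.QuantumFieldTheory.ContinuumLimits
import Mathlib.MeasureTheory.Constructions.BorelSpace.Metrizable
import HarnessLib

/-!
# `YM₂` on the lattice torus, I: measurability of continuous functions of edge words

First of the sibling proof files of
`Literature/MathematicalPhysics/QuantumFieldTheory/ContinuumLimits.lean` leading to the discharge
`ym2_exists_heatKernel_holds` of the named fact `ym2_exists_heatKernel` (Sengupta, Mem. AMS 600
(1997) Thm 4.2; Driver, CMP 123 (1989)): the exact solution of the heat-kernel lattice gauge
theory on the two-dimensional torus and its continuum/infinite-volume limit.

The structure group `G` in `ym2_exists_heatKernel` is an arbitrary compact (connected) topological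
group with its Borel σ-algebra — no second countability is assumed — so multiplication
`G × G → G` is not known to be measurable for the *product* σ-algebra, and neither are the
plaquette holonomies `U ↦ U_q` on `Edge → G`.  What is true, and suffices for every Fubini/Tonelli
manipulation below, is that `U ↦ φ (w(U))` is measurable for every *continuous* `φ : G → ℝ` and every
word `w` in the edge variables.  This file proves it: the class of maps `w : X → G` with
`φ ∘ w` measurable for all continuous real `φ` contains the measurable maps and is closed under
inversion and (the point) multiplication — by left uniform continuity of `φ` on the compact group,
`φ (f x * g x)` is the uniform limit of the measurable functions `φ (cᵢ * g x)` on the pieces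
`{x | f x cᵢ⁻¹ ∈ V}` of a finite cover of `G` by right translates of a small *functionally open*
neighbourhood `V` of `1` (complete regularity of compact groups), and limits of measurable real
functions are measurable.

No definition or statement of the tree is changed; everything here is proved.  [folklore]
-/

noncomputable section

open MeasureTheory Filter Topology

namespace Literature.MathematicalPhysics.QuantumFieldTheory.YM2

variable {G : Type*} [Group G] [TopologicalSpace G] [IsTopologicalGroup G] [CompactSpace G]

/-- Left uniform continuity of a continuous real function on a compact group: for `ε > 0` there is
an open `V ∋ 1` with `|φ (v y) - φ y| < ε` for all `v ∈ V`, `y ∈ G` (tube lemma). [folklore] -/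
theorem exists_nhds_one_forall_abs_sub_lt (φ : G → ℝ) (hφ : Continuous φ) {ε : ℝ} (hε : 0 < ε) :
    ∃ V : Set G, IsOpen V ∧ (1 : G) ∈ V ∧ ∀ v ∈ V, ∀ y, |φ (v * y) - φ y| < ε := by
  set n : Set (G × G) := {q | |φ (q.1 * q.2) - φ q.2| < ε} with hn
  have hno : IsOpen n := isOpen_lt (by fun_prop) continuous_const
  have hsub : ({1} : Set G) ×ˢ (Set.univ : Set G) ⊆ n := by
    rintro ⟨v, y⟩ ⟨hv, -⟩
    simp only [Set.mem_singleton_iff] at hv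
    simp [hn, hv, hε]
  obtain ⟨u, w, hu, -, h1u, hw, huw⟩ :=
    generalized_tube_lemma isCompact_singleton isCompact_univ hno hsub
  exact ⟨u, hu, h1u rfl, fun v hv y => huw (Set.mk_mem_prod hv (hw (Set.mem_univ y)))⟩

/-- A compact group is covered by finitely many right translates `V c` of any open `V ∋ 1`:
every `x` has `x c⁻¹ ∈ V` for some `c` in a fixed finite set. [folklore] -/
theorem exists_finset_forall_mul_inv_mem {V : Set G} (hV : IsOpen V) (h1 : (1 : G) ∈ V) :
    ∃ s : Finset G, ∀ x : G, ∃ c ∈ s, x * c⁻¹ ∈ V := by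
  have hcov : (Set.univ : Set G) ⊆ ⋃ c : G, (fun x => x * c⁻¹) ⁻¹' V := fun x _ =>
    Set.mem_iUnion.2 ⟨x, by simp [h1]⟩
  obtain ⟨s, hs⟩ := isCompact_univ.elim_finite_subcover (fun c : G => (fun x => x * c⁻¹) ⁻¹' V)
    (fun c => hV.preimage (by fun_prop)) hcov
  refine ⟨s, fun x => ?_⟩
  simpa only [Set.mem_iUnion, Set.mem_preimage, exists_prop] using hs (Set.mem_univ x)

/-- Complete regularity of a compact group at the identity: an open `W ∋ 1` contains the
functionally open neighbourhood `{ψ < 1/2}` of a continuous `ψ : G → ℝ` with `ψ 1 = 0` and `ψ = 1`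
off `W`. [folklore] -/
theorem exists_continuous_eq_zero_one {W : Set G} (hW : IsOpen W) (h1 : (1 : G) ∈ W) :
    ∃ ψ : G → ℝ, Continuous ψ ∧ ψ 1 = 0 ∧ ∀ x, x ∉ W → ψ x = 1 := by
  obtain ⟨f, hf, hf1, hfW⟩ := CompletelyRegularSpace.completely_regular_isOpen (1 : G) W hW h1
  refine ⟨fun x => (f x : ℝ), by fun_prop, by simp [hf1], fun x hx => ?_⟩
  have hx' : f x = (1 : G → unitInterval) x := hfW hx
  simp [hx']

/-- **Continuous functions of a product of two group-valued maps are measurable.**  If every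
continuous real function of `f` and of `g` is measurable, then so is every continuous real function
of the pointwise product `f g` — although `(a, b) ↦ a b` need not be measurable for the product of
the Borel σ-algebras when `G` is not second countable.  Proof: uniform approximation of `φ (f g)` by
the measurable functions `x ↦ φ (cᵢ g(x))` on `{x | ψ (f x cᵢ⁻¹) < 1/2}`, `(cᵢ)` a finite net. [folklore] -/
theorem measurable_comp_mul {X : Type*} [MeasurableSpace X] {f g : X → G}
    (hf : ∀ φ : G → ℝ, Continuous φ → Measurable fun x => φ (f x))
    (hg : ∀ φ : G → ℝ, Continuous φ → Measurable fun x => φ (g x))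
    (φ : G → ℝ) (hφ : Continuous φ) : Measurable fun x => φ (f x * g x) := by
  have key : ∀ k : ℕ, ∃ A : X → ℝ, Measurable A ∧ ∀ x, |φ (f x * g x) - A x| < 1 / (k + 1) := by
    intro k
    have hk : (0 : ℝ) < 1 / (k + 1) := by positivity
    obtain ⟨W, hWo, h1W, hW⟩ := exists_nhds_one_forall_abs_sub_lt φ hφ hk
    obtain ⟨ψ, hψ, hψ1, hψW⟩ := exists_continuous_eq_zero_one hWo h1W
    set V : Set G := {y | ψ y < 1 / 2} with hV
    have hVo : IsOpen V := isOpen_lt hψ continuous_const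
    have h1V : (1 : G) ∈ V := by simp [hV, hψ1]
    have hVW : ∀ y ∈ V, y ∈ W := by
      intro y hy
      by_contra hyW
      have h1 := hψW y hyW
      simp only [hV, Set.mem_setOf_eq, h1] at hy
      linarith
    obtain ⟨s, hs⟩ := exists_finset_forall_mul_inv_mem hVo h1V
    let A : List G → X → ℝ := fun l x =>
      l.foldr (fun c acc => if ψ (f x * c⁻¹) < 1 / 2 then φ (c * g x) else acc) 0
    have hAm : ∀ l, Measurable (A l) := by
      intro l
      induction l with
      | nil => exact measurable_const
      | cons c l ih =>
        simp only [A, List.foldr_cons]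
        refine Measurable.ite ?_ (hg (fun y => φ (c * y)) (by fun_prop)) ih
        exact measurableSet_lt (hf (fun y => ψ (y * c⁻¹)) (by fun_prop)) measurable_const
    have hAapprox : ∀ (l : List G) (x : X), (∃ c ∈ l, f x * c⁻¹ ∈ V) →
        |φ (f x * g x) - A l x| < 1 / (k + 1) := by
      intro l
      induction l with
      | nil =>
        rintro x ⟨c, hc, -⟩
        simp at hc
      | cons c l ih =>
        intro x hx
        simp only [A, List.foldr_cons]
        by_cases hc : ψ (f x * c⁻¹) < 1 / 2
        · rw [if_pos hc]
          have h := hW _ (hVW _ hc) (c * g x)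
          rwa [show f x * c⁻¹ * (c * g x) = f x * g x by group] at h
        · rw [if_neg hc]
          apply ih
          obtain ⟨c', hc', hc'V⟩ := hx
          rcases List.mem_cons.1 hc' with rfl | h
          · exact absurd hc'V hc
          · exact ⟨c', h, hc'V⟩
    refine ⟨A s.toList, hAm _, fun x => hAapprox _ x ?_⟩
    obtain ⟨c, hc, hcV⟩ := hs (f x)
    exact ⟨c, Finset.mem_toList.2 hc, hcV⟩
  choose A hAm hA using key
  refine measurable_of_tendsto_metrizable hAm ?_
  rw [tendsto_pi_nhds]
  intro x
  rw [Metric.tendsto_atTop]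
  intro ε hε
  obtain ⟨N, hN⟩ := exists_nat_one_div_lt hε
  refine ⟨N, fun k hk => ?_⟩
  rw [Real.dist_eq, abs_sub_comm]
  calc |φ (f x * g x) - A k x| < 1 / (k + 1) := hA k x
    _ ≤ 1 / (N + 1) := by gcongr
    _ < ε := hN

/-- Measurable maps pull back continuous functions measurably (Borel σ-algebra on `G`). [folklore] -/
theorem measurable_comp_of_measurable {H X : Type*} [TopologicalSpace H] [MeasurableSpace H]
    [OpensMeasurableSpace H] [MeasurableSpace X] {f : X → H} (hf : Measurable f) (φ : H → ℝ)
    (hφ : Continuous φ) : Measurable fun x => φ (f x) :=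
  hφ.measurable.comp hf

/-- Coordinate projections of `ι → G` pull back continuous functions measurably. [folklore] -/
theorem measurable_comp_apply {H ι : Type*} [TopologicalSpace H] [MeasurableSpace H]
    [OpensMeasurableSpace H] (i : ι) (φ : H → ℝ) (hφ : Continuous φ) :
    Measurable fun U : ι → H => φ (U i) :=
  hφ.measurable.comp (measurable_pi_apply i)

/-- Constant maps pull back continuous functions measurably. [folklore] -/
theorem measurable_comp_const {H X : Type*} [TopologicalSpace H] [MeasurableSpace X] (c : H)
    (φ : H → ℝ) (_hφ : Continuous φ) : Measurable fun _ : X => φ c :=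
  measurable_const

omit [CompactSpace G] in
/-- Closure under inversion: `φ ∘ (·)⁻¹` is again continuous. [folklore] -/
theorem measurable_comp_inv {X : Type*} [MeasurableSpace X] {f : X → G}
    (hf : ∀ φ : G → ℝ, Continuous φ → Measurable fun x => φ (f x))
    (φ : G → ℝ) (hφ : Continuous φ) : Measurable fun x => φ (f x)⁻¹ :=
  hf (fun y => φ y⁻¹) (hφ.comp continuous_inv)

/-- Closure under ordered finite products `w₀(x) w₁(x) ⋯ w_{n-1}(x)` (as a `List.prod` over
`List.range n`). [folklore] -/
theorem measurable_comp_prod_range {X : Type*} [MeasurableSpace X] {w : ℕ → X → G}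
    (hw : ∀ k, ∀ φ : G → ℝ, Continuous φ → Measurable fun x => φ (w k x)) (n : ℕ)
    (φ : G → ℝ) (hφ : Continuous φ) :
    Measurable fun x => φ (((List.range n).map fun k => w k x).prod) := by
  induction n generalizing φ with
  | zero => simp
  | succ n ih =>
    simp only [List.range_succ, List.map_append, List.map_cons, List.map_nil,
      List.prod_append, List.prod_cons, List.prod_nil, mul_one]
    exact measurable_comp_mul ih (hw n) φ hφ

/-- The basic integrands: `x ↦ ENNReal.ofReal (ψ (w x))` is measurable for continuous `ψ` and a
word map `w`. [folklore] -/
theorem measurable_ofReal_comp {H X : Type*} [TopologicalSpace H] [MeasurableSpace X] {w : X → H}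
    (hw : ∀ φ : H → ℝ, Continuous φ → Measurable fun x => φ (w x))
    (ψ : H → ℝ) (hψ : Continuous ψ) : Measurable fun x => ENNReal.ofReal (ψ (w x)) :=
  ENNReal.measurable_ofReal.comp (hw ψ hψ)

end Literature.MathematicalPhysics.QuantumFieldTheory.YM2
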